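import Summits.QuantumFields.YangMills.Theorems.PoincareLipschitzConeLinkPushforward
import Summits.QuantumFields.YangMills.Theorems.PoincareLipschitzConeLinkGoodSlice
import Literature.Analysis.FunctionSpaces.DistributionalConstancy
import HarnessLib

/-!
# Crux `BlockLipschitzL` (stmt-QuantumFields-23533) ∕ `HistoryTailL` (stmt-QuantumFields-19936), LINE 25 «CompactnessTransfer»,
# stub S1″ — ROAD (H) «SU(2) currents ⇒ H-system ⇒ 8π quantum», brick (T) «CONE → PLANE TRANSPORT», FILE D4 «THE LINK IS SOBOLEV»

Cell `ym3-torus` (YM ladder rung R3 = continuum SU(2) Yang–Mills on T³ — a RUNG, NOT Clay: not d = 4, not infinite volume,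
not a mass gap); WIDTH helper seat `ym3-torus-px14` g7 (brick (T) of px19 g8's ROAD (H), architecture v1).  Helper
`--supports stmt-QuantumFields-23533`; THEOREMS ONLY (0 `def`, 0 `sorry`, default heartbeats); imports FILE D2
✓`PoincareLipschitzConeLinkPushforward` (push-forward fields; pulls D1 cut-offs and px16 g10's A1–A3 chart letters), FILE D3
✓`PoincareLipschitzConeLinkGoodSlice` (slab measure), lit
✓`DistributionalConstancy` (a normalised bump `χ`), HarnessLib.

WHAT THIS FILE PROVES — ROW (T-1) OF THE DOOR, on the D-row letters (`LETTERS-D-rows.px14g7.txt`): if `U` has the weak gradient `G`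
on an open `Ω ⊇ B̄_{1∕8}(0)` and `w : E² → F`, `Gw : E² → (E² →L F)` are locally integrable with `U (t•σ y) = w y` and
`(G (t•σ y)) ∘L (t • Dσ_y) = Gw y` for a.e. `(t,y)` in the slab `(0,1∕4) × E²`, then ★★★ `hasWeakFDerivOn_link`:
`Gw` IS THE WEAK GRADIENT OF `w` ON ALL OF `E²` (lit `HasWeakFDerivOn ⟨univ, _⟩ volume w Gw`).  Proof («test side only»): for a test
`φ` on `E²` and `v ∈ E²`, with `χ ∈ C_c^∞((1∕16, 1∕8))`, `∫χ = 1`: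
`∫ ∂_vφ • w = ∫_S (χ(t)∂_vφ(y)) • U(t•σy) = ∫ Ψ • U` (change of variables, `Ψ = χ(‖x‖)(∂_vφ)(πx)∕(‖x‖+x₂)²`)
`= ∫ (div Z) • U` (D2: `div Z = Ψ` a.e.) `= −∫ G_x(Z x)` (weak gradient against the field `Z`, whose components are test
functions on `Ω`) `= −∫_S (χ(t)φ(y)) • Gw_y v = −∫ φ • Gw v`.

HONEST SCOPE.  Sobolev calculus; nothing of (GAP)∕(TM), (C), S1″, K1, `MeanDeviationL`, `BlockLipschitzL`, `HistoryTailL` is proved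
here.  YM₃ on T³ is rung R3, not Clay; YM gap NOT proved; no summit statement is proved here.

References: L. C. Evans, Partial Differential Equations, 2nd ed. (2010) [Evans2010] (§5.2.1); L. Simon, Theorems on Regularity and
Singularity of Energy Minimizing Maps (1996) [Simon1996] (§3.1).
-/

set_option autoImplicit false

noncomputable section

open MeasureTheory Set Function Filter Topology Metric TopologicalSpace
open scoped RealInnerProductSpace BigOperators ContDiff

namespace Summit.QuantumFields.YangMills.Theorems.PoincareLipschitzConeLinkWeakDeriv

open Literature.Analysis.FunctionSpaces (IsTestFunctionOn HasWeakFDerivOn exists_contDiff_tsupport_subset_Ioo_integral_eq_one)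
open Summit.QuantumFields.YangMills.Theorems.PoincareLipschitzConeLinkChart
open Summit.QuantumFields.YangMills.Theorems.PoincareLipschitzConeLinkCutoff
open Summit.QuantumFields.YangMills.Theorems.PoincareLipschitzConeLinkPushforward
open Summit.QuantumFields.YangMills.Theorems.PoincareLipschitzConeLinkGoodSlice (volume_restrict_slab)

variable {c : EuclideanSpace ℝ (Fin 2) → ℝ} {σ : EuclideanSpace ℝ (Fin 2) → EuclideanSpace ℝ (Fin 3)}
  {π : EuclideanSpace ℝ (Fin 3) → EuclideanSpace ℝ (Fin 2)}
variable {F : Type*} [NormedAddCommGroup F] [NormedSpace ℝ F] [CompleteSpace F]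

/-! ## §1 Product integrals over the slab -/

/-- **A normalised bump in `t` disappears**: `∫_S (χ(t)·a(y)) • g(y) = ∫ a • g` when `∫χ = 1` and `tsupport χ ⊆ (0,R)`. [folklore] -/
theorem setIntegral_slab_mul_smul {W : Type*} [NormedAddCommGroup W] [NormedSpace ℝ W] {R : ℝ}
    {χ : ℝ → ℝ} (hχs : tsupport χ ⊆ Ioo 0 R) (hχ1 : ∫ t, χ t = 1)
    (a : EuclideanSpace ℝ (Fin 2) → ℝ) (g : EuclideanSpace ℝ (Fin 2) → W) :
    ∫ q in Ioo (0:ℝ) R ×ˢ (univ : Set (EuclideanSpace ℝ (Fin 2))), (χ q.1 * a q.2) • g q.2 = ∫ y, a y • g y := by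
  have h1 : ∫ t in Ioo (0:ℝ) R, χ t = 1 := by
    rw [setIntegral_eq_integral_of_forall_compl_eq_zero fun t ht => image_eq_zero_of_notMem_tsupport fun h => ht (hχs h),
      hχ1]
  rw [volume_restrict_slab]
  simp_rw [mul_smul]
  rw [integral_prod_smul (μ := volume.restrict (Ioo (0:ℝ) R)) χ (fun y => a y • g y), h1, one_smul]

/-! ## §2 The link is Sobolev -/

/-- ★★★ **ROW (T-1): `Gw` IS THE WEAK GRADIENT OF THE LINK `w` ON `E²`.**  Let `U` have the weak gradient `G` on an open
`Ω ⊇ B̄_{1∕8}(0)`, and let `w`, `Gw` be locally integrable on `E²` with `U (t•σ y) = w y` and `(G (t•σ y)) ∘L (t • Dσ_y) = Gw y`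
for a.e. `(t,y) ∈ (0,1∕4) × E²`.  Then `HasWeakFDerivOn ⟨univ, _⟩ volume w Gw`. [cite: Evans2010, §5.2.1; Simon1996, §3.1] -/
theorem hasWeakFDerivOn_link (hc : ∀ y, c y = 2 / (1 + ‖y‖ ^ 2))
    (hσ : ∀ y, σ y = !₂[c y * y 0, c y * y 1, c y - 1])
    (hπ : ∀ x, π x = (‖x‖ + x 2)⁻¹ • !₂[x 0, x 1])
    {Ω : Opens (EuclideanSpace ℝ (Fin 3))} (hΩ : closedBall (0 : EuclideanSpace ℝ (Fin 3)) (1/8) ⊆ (Ω : Set _))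
    {U : EuclideanSpace ℝ (Fin 3) → F} {G : EuclideanSpace ℝ (Fin 3) → (EuclideanSpace ℝ (Fin 3) →L[ℝ] F)}
    (hU : HasWeakFDerivOn Ω volume U G)
    {w : EuclideanSpace ℝ (Fin 2) → F} {Gw : EuclideanSpace ℝ (Fin 2) → (EuclideanSpace ℝ (Fin 2) →L[ℝ] F)}
    (hw : LocallyIntegrable w volume) (hGw : LocallyIntegrable Gw volume)
    (hVw : ∀ᵐ q ∂(volume.restrict (Ioo (0:ℝ) (1/4) ×ˢ (univ : Set (EuclideanSpace ℝ (Fin 2))))),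
      U (q.1 • σ q.2) = w q.2)
    (hHw : ∀ᵐ q ∂(volume.restrict (Ioo (0:ℝ) (1/4) ×ˢ (univ : Set (EuclideanSpace ℝ (Fin 2))))),
      (G (q.1 • σ q.2)).comp (q.1 • fderiv ℝ σ q.2) = Gw q.2) :
    HasWeakFDerivOn ⟨univ, isOpen_univ⟩ volume w Gw := by
  refine ⟨hw.locallyIntegrableOn _, hGw.locallyIntegrableOn _, fun φ v hφ => ?_⟩
  show ∫ y in univ, (fderiv ℝ φ y v) • w y = -∫ y in univ, φ y • Gw y v
  simp only [Measure.restrict_univ]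
  -- the bump in `t`
  obtain ⟨χ, hχ, hχc, hχs, hχ1⟩ := exists_contDiff_tsupport_subset_Ioo_integral_eq_one (by norm_num : (1/16 : ℝ) < 1/8)
  have hχs' : tsupport χ ⊆ Icc (1/16 : ℝ) (1/8) := hχs.trans Ioo_subset_Icc_self
  have hχS : tsupport χ ⊆ Ioo (0 : ℝ) (1/4) := hχs.trans (Ioo_subset_Ioo (by norm_num) (by norm_num))
  have hφs : ContDiff ℝ ∞ φ := hφ.contDiff
  have hφc : HasCompactSupport φ := hφ.hasCompactSupport
  have hφ' : ContDiff ℝ ∞ fun y => fderiv ℝ φ y v := (hφs.fderiv_right le_rfl).clm_apply contDiff_const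
  have hφ'c : HasCompactSupport fun y => fderiv ℝ φ y v := hφc.fderiv_apply (𝕜 := ℝ) v
  -- the field `Z` and the source `Ψ`
  set V : Set (EuclideanSpace ℝ (Fin 3)) := {x | 0 < ‖x‖ + x 2} with hV
  set gZ : EuclideanSpace ℝ (Fin 3) → EuclideanSpace ℝ (Fin 3) :=
    fun x => (((‖x‖ + x 2) ^ 2)⁻¹ * ‖x‖) • fderiv ℝ σ (π x) v with hgZ
  set Z : EuclideanSpace ℝ (Fin 3) → EuclideanSpace ℝ (Fin 3) := V.indicator (fun x => (χ ‖x‖ * φ (π x)) • gZ x) with hZ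
  set Ψ : EuclideanSpace ℝ (Fin 3) → ℝ := V.indicator (fun x => (χ ‖x‖ * fderiv ℝ φ (π x) v) • ((‖x‖ + x 2) ^ 2)⁻¹) with hΨ
  have hσs := contDiff_sigma hc hσ
  have hV0 : ∀ x ∈ V, x ≠ 0 := by
    rintro x hx rfl
    simp [hV] at hx
  have hJinv : ContDiffOn ℝ ∞ (fun x : EuclideanSpace ℝ (Fin 3) => ((‖x‖ + x 2) ^ 2)⁻¹) V := by
    refine ((contDiffOn_id.norm ℝ hV0).add (contDiff_apply_three 2).contDiffOn).pow 2 |>.inv fun x hx => ?_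
    exact pow_ne_zero 2 (ne_of_gt hx)
  have hgZs : ContDiffOn ℝ ∞ gZ V := by
    refine (hJinv.mul (contDiffOn_id.norm ℝ hV0)).smul ?_
    exact ((hσs.fderiv_right le_rfl).comp_contDiffOn (contDiffOn_pi hπ)).clm_apply contDiffOn_const
  have hZt : IsTestFunctionOn Ω Z :=
    isTestFunctionOn_coneCutoff hπ hχ (by norm_num) hχs' hφs hφc hgZs hΩ
  have hZi : ∀ i : Fin 3, IsTestFunctionOn Ω (fun x => Z x i) := fun i => isTestFunctionOn_apply hZt i
  have hΨt : IsTestFunctionOn Ω Ψ := isTestFunctionOn_coneCutoff hπ hχ (by norm_num) hχs' hφ' hφ'c hJinv hΩ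
  -- supports inside the ball `B_{1/4}(0)`
  have hB : closedBall (0 : EuclideanSpace ℝ (Fin 3)) (1/8) ⊆
      ((⟨ball (0 : EuclideanSpace ℝ (Fin 3)) (1/4), isOpen_ball⟩ : Opens (EuclideanSpace ℝ (Fin 3))) : Set _) :=
    closedBall_subset_ball (by norm_num)
  have hsuppZ : ∀ x, x ∉ ball (0 : EuclideanSpace ℝ (Fin 3)) (1/4) → Z x = 0 := fun x hx =>
    image_eq_zero_of_notMem_tsupport fun h =>
      hx ((isTestFunctionOn_coneCutoff hπ hχ (by norm_num) hχs' hφs hφc hgZs hB).tsupport_subset h)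
  have hsuppΨ : ∀ x, x ∉ ball (0 : EuclideanSpace ℝ (Fin 3)) (1/4) → Ψ x = 0 := fun x hx =>
    image_eq_zero_of_notMem_tsupport fun h =>
      hx ((isTestFunctionOn_coneCutoff hπ hχ (by norm_num) hχs' hφ' hφ'c hJinv hB).tsupport_subset h)
  -- values on the cone
  have hZΦ : ∀ {t : ℝ} (ht : 0 < t) (y : EuclideanSpace ℝ (Fin 2)),
      Z (t • σ y) = ((χ t * φ y) * (((t * c y) ^ 2)⁻¹ * t)) • fderiv ℝ σ y v := by
    intro t ht y
    rw [hZ, coneCutoff_smul_sigma hc hσ hπ χ φ gZ ht y, hgZ]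
    simp only
    rw [norm_add_apply_two_smul_sigma hc hσ ht, norm_smul_sigma hc hσ, abs_of_pos ht, pi_smul_sigma hc hσ hπ ht,
      smul_smul]
  have hΨΦ : ∀ {t : ℝ} (ht : 0 < t) (y : EuclideanSpace ℝ (Fin 2)),
      Ψ (t • σ y) = (χ t * fderiv ℝ φ y v) * ((t * c y) ^ 2)⁻¹ := by
    intro t ht y
    rw [hΨ, coneCutoff_smul_sigma hc hσ hπ χ (fun y => fderiv ℝ φ y v) (fun x => ((‖x‖ + x 2) ^ 2)⁻¹) ht y,
      norm_add_apply_two_smul_sigma hc hσ ht, smul_eq_mul]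
  have hJ : ∀ {t : ℝ} (ht : 0 < t) (y : EuclideanSpace ℝ (Fin 2)), (t ^ 2 * c y ^ 2) * (((t * c y) ^ 2)⁻¹ * t) = t := by
    intro t ht y
    have hc0 : c y ≠ 0 := (c_pos hc y).ne'
    field_simp
  have hJ' : ∀ {t : ℝ} (ht : 0 < t) (y : EuclideanSpace ℝ (Fin 2)), (t ^ 2 * c y ^ 2) * ((t * c y) ^ 2)⁻¹ = 1 := by
    intro t ht y
    have hc0 : c y ≠ 0 := (c_pos hc y).ne'
    field_simp
  -- LEFT: `∫ ∂_vφ • w = ∫ (div Z) • U`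
  have hL : ∫ y, (fderiv ℝ φ y v) • w y =
      ∫ x, (∑ i : Fin 3, fderiv ℝ (fun x => Z x i) x (EuclideanSpace.single i (1:ℝ))) • U x := by
    calc ∫ y, (fderiv ℝ φ y v) • w y
        = ∫ q in Ioo (0:ℝ) (1/4) ×ˢ (univ : Set (EuclideanSpace ℝ (Fin 2))), (χ q.1 * fderiv ℝ φ q.2 v) • w q.2 :=
          (setIntegral_slab_mul_smul hχS hχ1 (fun y => fderiv ℝ φ y v) w).symm
      _ = ∫ q in Ioo (0:ℝ) (1/4) ×ˢ (univ : Set (EuclideanSpace ℝ (Fin 2))), (χ q.1 * fderiv ℝ φ q.2 v) • U (q.1 • σ q.2) := by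
          refine integral_congr_ae ?_
          filter_upwards [hVw] with q hq
          rw [hq]
      _ = ∫ q in Ioo (0:ℝ) (1/4) ×ˢ (univ : Set (EuclideanSpace ℝ (Fin 2))),
            (q.1 ^ 2 * c q.2 ^ 2) • (Ψ (q.1 • σ q.2) • U (q.1 • σ q.2)) := by
          refine setIntegral_congr_fun (measurableSet_Ioo.prod MeasurableSet.univ) ?_
          rintro ⟨t, y⟩ hq
          have ht : 0 < t := (mem_prod.1 hq).1.1
          simp only
          rw [hΨΦ ht y, smul_smul]
          congr 1
          calc χ t * fderiv ℝ φ y v = χ t * fderiv ℝ φ y v * ((t ^ 2 * c y ^ 2) * ((t * c y) ^ 2)⁻¹) := by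
                rw [hJ' ht y, mul_one]
            _ = t ^ 2 * c y ^ 2 * (χ t * fderiv ℝ φ y v * ((t * c y) ^ 2)⁻¹) := by ring
      _ = ∫ x in ball (0 : EuclideanSpace ℝ (Fin 3)) (1/4), Ψ x • U x :=
          (setIntegral_ball_eq_integral_chart hc hσ (1/4) (fun x => Ψ x • U x)).symm
      _ = ∫ x, Ψ x • U x := setIntegral_eq_integral_of_forall_compl_eq_zero fun x hx => by rw [hsuppΨ x hx, zero_smul]
      _ = ∫ x, (∑ i : Fin 3, fderiv ℝ (fun x => Z x i) x (EuclideanSpace.single i (1:ℝ))) • U x := by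
          refine integral_congr_ae ?_
          filter_upwards [div_coneField_ae_eq hc hσ hπ hχ (by norm_num : (0:ℝ) < 1/16) hχs' hφs hφc v] with x hx
          rw [hx]
  -- RIGHT: `∫ G_x (Z x) = ∫ φ • Gw v`
  have hR : ∫ x, G x (Z x) = ∫ y, φ y • Gw y v := by
    calc ∫ x, G x (Z x)
        = ∫ x in ball (0 : EuclideanSpace ℝ (Fin 3)) (1/4), G x (Z x) :=
          (setIntegral_eq_integral_of_forall_compl_eq_zero fun x hx => by rw [hsuppZ x hx, map_zero]).symm
      _ = ∫ q in Ioo (0:ℝ) (1/4) ×ˢ (univ : Set (EuclideanSpace ℝ (Fin 2))),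
            (q.1 ^ 2 * c q.2 ^ 2) • G (q.1 • σ q.2) (Z (q.1 • σ q.2)) :=
          setIntegral_ball_eq_integral_chart hc hσ (1/4) (fun x => G x (Z x))
      _ = ∫ q in Ioo (0:ℝ) (1/4) ×ˢ (univ : Set (EuclideanSpace ℝ (Fin 2))),
            (χ q.1 * φ q.2) • ((G (q.1 • σ q.2)).comp (q.1 • fderiv ℝ σ q.2)) v := by
          refine setIntegral_congr_fun (measurableSet_Ioo.prod MeasurableSet.univ) ?_
          rintro ⟨t, y⟩ hq
          have ht : 0 < t := (mem_prod.1 hq).1.1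
          simp only
          rw [hZΦ ht y, map_smul, smul_smul, ContinuousLinearMap.comp_apply, FunLike.coe_smul, Pi.smul_apply, map_smul,
            smul_smul]
          congr 1
          calc t ^ 2 * c y ^ 2 * (χ t * φ y * (((t * c y) ^ 2)⁻¹ * t))
              = χ t * φ y * ((t ^ 2 * c y ^ 2) * (((t * c y) ^ 2)⁻¹ * t)) := by ring
            _ = χ t * φ y * t := by rw [hJ ht y]
      _ = ∫ q in Ioo (0:ℝ) (1/4) ×ˢ (univ : Set (EuclideanSpace ℝ (Fin 2))), (χ q.1 * φ q.2) • Gw q.2 v := by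
          refine integral_congr_ae ?_
          filter_upwards [hHw] with q hq
          rw [← hq]
      _ = ∫ y, φ y • Gw y v := setIntegral_slab_mul_smul hχS hχ1 φ (fun y => Gw y v)
  rw [hL, integral_div_smul_eq_neg_integral_weakGrad hU hZi, hR]

end Summit.QuantumFields.YangMills.Theorems.PoincareLipschitzConeLinkWeakDeriv

end
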